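import Summits.QuantumFields.YangMills.Theorems.AllWindowsColdBoxBoxHighLineGaussianChartWick
import Summits.QuantumFields.YangMills.Theorems.AllWindowsColdBoxBoxHighLineGaussianDeterminant

/-!
# T-S5.4w′ «Wick's theorem for a general positive-definite precision» — `exp(−β vᵀP v) dv`, `P` positive definite

Corollary file of ✓T-S5.4w `GaussianChartWick` (planner ym-idea-2 g17's step (1b)/(2) for the XL comparison stubs S5 = LINE-19
⟨stmt-QuantumFields-24004⟩/⟨24335⟩ `stub_landauSecondOrder` and U5 = LINE-20 ⟨24336⟩).  4w is stated for the Faddeev–Popov form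
`exp(−β ‖M v‖²)` (invertible `M`); the MAIN Gaussian of the second-order expansion (STEP1b §4–5: link fluctuations with the chart's precision
`hodgeQ`, fcl-p3 g25's 4k letters `e^{−½ vᵀPv}`, `Z(P) = √(2π)^{|ι|}/√det P`) is given by a positive-definite PRECISION `P` instead.  Writing
`P = MᵀM` with `M = √P` (Mathlib's continuous-functional-calculus square root on the C⋆-ordered ring of real matrices) transports every
statement of 4w:

* `exists_transpose_mul_self_of_posDef` — `P.PosDef → ∃ M, Mᵀ * M = P ∧ M.det ≠ 0`;
* `abs_det_eq_sqrt_det_of_transpose_mul_self` — `Mᵀ M = P ⇒ |det M| = √(det P)`;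
* **`integral_exp_neg_quadForm`** — `∫ exp(−β vᵀPv) dv = √(π/β)ⁿ/√(det P)` (the normalisation; `β = ½` gives `Z(P)`);
* **`integral_prod_dotProduct_mul_exp_quadForm_eq_pairingSum`** — WICK: `∫ (∏_{i<2k} ℓ_i ⬝ᵥ v) exp(−β vᵀPv) dv = √(π/β)ⁿ/√(det P) · 𝒢_k[S](ℓ)`,
  `S(a,b) = (2β)⁻¹ · a ⬝ᵥ P⁻¹ b`; odd products vanish (`integral_prod_dotProduct_mul_exp_quadForm_odd`); `k = 1, 2` spelled out
  (`integral_dotProduct_mul_dotProduct_mul_exp_quadForm`, `integral_four_dotProduct_mul_exp_quadForm`).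

Tree (✓GaussianChartWick, ✓GaussianMoments) + Mathlib; no definitions.  HONEST LABEL: infrastructure for step (2) of the XL stubs S5/U5; T-S5.4,
S5, U5, ⟨24004⟩ ⟨24335⟩ ⟨24336⟩ remain OPEN; no summit is proved; the Yang–Mills mass gap is NOT proved by this file.
Seat ym-line-sfw-p2 g77 (LEAD, cell ym-idea-1).
-/

set_option autoImplicit false

noncomputable section

open MeasureTheory Matrix Finset
open scoped MatrixOrder
open Literature.Probability.LatticeModels (pairingSum pairingSum_congr_of_eq)

namespace Summit.QuantumFields.YangMills.Theorems.AllWindowsColdBoxBoxHighLine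

namespace GaussianChartWick

variable {n : ℕ}

/-- A real positive-definite matrix is `MᵀM` for an invertible real `M` (`M = √P` from the continuous functional calculus). -/
theorem exists_transpose_mul_self_of_posDef (P : Matrix (Fin n) (Fin n) ℝ) (hP : P.PosDef) :
    ∃ M : Matrix (Fin n) (Fin n) ℝ, Mᵀ * M = P ∧ M.det ≠ 0 := by
  have h0 : 0 ≤ P := hP.posSemidef.nonneg
  set M : Matrix (Fin n) (Fin n) ℝ := CFC.sqrt P with hM
  have hMM : M * M = P := CFC.sqrt_mul_sqrt_self P h0
  have hMpsd : M.PosSemidef := (CFC.sqrt_nonneg P).posSemidef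
  have hMt : Mᵀ = M := by
    have h := hMpsd.isHermitian
    rwa [Matrix.IsHermitian, Matrix.conjTranspose_eq_transpose_of_trivial] at h
  refine ⟨M, by rw [hMt, hMM], fun hdet => ?_⟩
  have hP' : P.det = M.det * M.det := by rw [← hMM, Matrix.det_mul]
  have := hP.det_pos
  rw [hP', hdet, mul_zero] at this
  exact lt_irrefl _ this

/-- `Mᵀ M = P ⇒ |det M| = √(det P)`. -/
theorem abs_det_eq_sqrt_det_of_transpose_mul_self {P M : Matrix (Fin n) (Fin n) ℝ} (hMP : Mᵀ * M = P) :
    |M.det| = Real.sqrt P.det := by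
  rw [← hMP, Matrix.det_mul, Matrix.det_transpose, ← sq, Real.sqrt_sq_eq_abs]

/-- `Mᵀ M = P ⇒ ‖M v‖² = vᵀPv`. -/
theorem mulVec_dotProduct_mulVec_of_transpose_mul_self {P M : Matrix (Fin n) (Fin n) ℝ} (hMP : Mᵀ * M = P) (v : Fin n → ℝ) :
    M *ᵥ v ⬝ᵥ M *ᵥ v = v ⬝ᵥ P *ᵥ v := by
  rw [mulVec_dotProduct_mulVec_eq, hMP]

end GaussianChartWick

open GaussianChartWick

/-- **Normalisation**: `∫ exp(−β vᵀPv) dv = √(π/β)ⁿ/√(det P)` for a positive-definite real `P` and `β > 0`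
(`β = ½`: the partition function `Z(P) = √(2π)ⁿ/√det P` of fcl-p3's 4k letters). -/
theorem integral_exp_neg_quadForm (n : ℕ) (P : Matrix (Fin n) (Fin n) ℝ) (hP : P.PosDef) {β : ℝ} (hβ : 0 < β) :
    ∫ v : Fin n → ℝ, Real.exp (-(β * (v ⬝ᵥ P *ᵥ v))) = Real.sqrt (Real.pi / β) ^ n / Real.sqrt P.det := by
  obtain ⟨M, hMP, hM⟩ := exists_transpose_mul_self_of_posDef P hP
  have h := gaussianDeterminantFormula n M hM β hβ
  simp only [mulVec_dotProduct_mulVec_of_transpose_mul_self hMP] at h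
  rw [h, abs_det_eq_sqrt_det_of_transpose_mul_self hMP]

/-- **WICK'S THEOREM for `exp(−β vᵀPv) dv`**, `P` positive definite, `β > 0`: for `2k` linear forms `ℓ_i`,
`∫ (∏_i ℓ_i ⬝ᵥ v) exp(−β vᵀPv) dv = √(π/β)ⁿ/√(det P) · 𝒢_k[S](ℓ)` with the propagator `S(a,b) = (2β)⁻¹ · a ⬝ᵥ P⁻¹ b`. -/
theorem integral_prod_dotProduct_mul_exp_quadForm_eq_pairingSum (n : ℕ) (P : Matrix (Fin n) (Fin n) ℝ) (hP : P.PosDef)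
    {β : ℝ} (hβ : 0 < β) (k : ℕ) (ℓ : Fin (2 * k) → (Fin n → ℝ)) :
    ∫ v : Fin n → ℝ, (∏ i, (ℓ i ⬝ᵥ v)) * Real.exp (-(β * (v ⬝ᵥ P *ᵥ v))) =
      Real.sqrt (Real.pi / β) ^ n / Real.sqrt P.det *
        pairingSum (fun a b : Fin n → ℝ => (2 * β)⁻¹ * (a ⬝ᵥ (P⁻¹ *ᵥ b))) k ℓ := by
  obtain ⟨M, hMP, hM⟩ := exists_transpose_mul_self_of_posDef P hP
  have h := integral_prod_dotProduct_mul_exp_eq_pairingSum n M hM hβ k ℓ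
  simp only [mulVec_dotProduct_mulVec_of_transpose_mul_self hMP, hMP] at h
  rw [h, abs_det_eq_sqrt_det_of_transpose_mul_self hMP]

/-- Odd moments of `exp(−β vᵀPv) dv` vanish. -/
theorem integral_prod_dotProduct_mul_exp_quadForm_odd (n : ℕ) (P : Matrix (Fin n) (Fin n) ℝ) (hP : P.PosDef)
    {β : ℝ} (hβ : 0 < β) (k : ℕ) (ℓ : Fin (2 * k + 1) → (Fin n → ℝ)) :
    ∫ v : Fin n → ℝ, (∏ i, (ℓ i ⬝ᵥ v)) * Real.exp (-(β * (v ⬝ᵥ P *ᵥ v))) = 0 := by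
  obtain ⟨M, hMP, hM⟩ := exists_transpose_mul_self_of_posDef P hP
  have h := integral_prod_dotProduct_mul_exp_odd n M hM hβ k ℓ
  simpa only [mulVec_dotProduct_mulVec_of_transpose_mul_self hMP] using h

/-- The propagator (`k = 1`): `∫ (a ⬝ᵥ v)(b ⬝ᵥ v) exp(−β vᵀPv) dv = √(π/β)ⁿ/√(det P) · (2β)⁻¹ · a ⬝ᵥ P⁻¹ b`. -/
theorem integral_dotProduct_mul_dotProduct_mul_exp_quadForm (n : ℕ) (P : Matrix (Fin n) (Fin n) ℝ) (hP : P.PosDef)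
    {β : ℝ} (hβ : 0 < β) (a b : Fin n → ℝ) :
    ∫ v : Fin n → ℝ, (a ⬝ᵥ v) * (b ⬝ᵥ v) * Real.exp (-(β * (v ⬝ᵥ P *ᵥ v))) =
      Real.sqrt (Real.pi / β) ^ n / Real.sqrt P.det * ((2 * β)⁻¹ * (a ⬝ᵥ (P⁻¹ *ᵥ b))) := by
  obtain ⟨M, hMP, hM⟩ := exists_transpose_mul_self_of_posDef P hP
  have h := integral_dotProduct_mul_dotProduct_mul_exp n M hM hβ a b
  simp only [mulVec_dotProduct_mulVec_of_transpose_mul_self hMP, hMP] at h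
  rw [h, abs_det_eq_sqrt_det_of_transpose_mul_self hMP]

/-- The four-point function (`k = 2`, the three pairings) against `exp(−β vᵀPv) dv`, with `S(a,b) = (2β)⁻¹ · a ⬝ᵥ P⁻¹ b`. -/
theorem integral_four_dotProduct_mul_exp_quadForm (n : ℕ) (P : Matrix (Fin n) (Fin n) ℝ) (hP : P.PosDef)
    {β : ℝ} (hβ : 0 < β) (ℓ₀ ℓ₁ ℓ₂ ℓ₃ : Fin n → ℝ) :
    ∫ v : Fin n → ℝ, (ℓ₀ ⬝ᵥ v) * (ℓ₁ ⬝ᵥ v) * (ℓ₂ ⬝ᵥ v) * (ℓ₃ ⬝ᵥ v) * Real.exp (-(β * (v ⬝ᵥ P *ᵥ v))) =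
      Real.sqrt (Real.pi / β) ^ n / Real.sqrt P.det *
        (((2 * β)⁻¹ * (ℓ₀ ⬝ᵥ (P⁻¹ *ᵥ ℓ₁))) * ((2 * β)⁻¹ * (ℓ₂ ⬝ᵥ (P⁻¹ *ᵥ ℓ₃))) +
         ((2 * β)⁻¹ * (ℓ₀ ⬝ᵥ (P⁻¹ *ᵥ ℓ₂))) * ((2 * β)⁻¹ * (ℓ₁ ⬝ᵥ (P⁻¹ *ᵥ ℓ₃))) +
         ((2 * β)⁻¹ * (ℓ₀ ⬝ᵥ (P⁻¹ *ᵥ ℓ₃))) * ((2 * β)⁻¹ * (ℓ₁ ⬝ᵥ (P⁻¹ *ᵥ ℓ₂)))) := by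
  obtain ⟨M, hMP, hM⟩ := exists_transpose_mul_self_of_posDef P hP
  have h := integral_four_dotProduct_mul_exp n M hM hβ ℓ₀ ℓ₁ ℓ₂ ℓ₃
  simp only [mulVec_dotProduct_mulVec_of_transpose_mul_self hMP, hMP] at h
  rw [h, abs_det_eq_sqrt_det_of_transpose_mul_self hMP]

/-- **Covariance of two squares** (the shape of S5's Gaussian main term `Cov_G(s(p)², s(q)²) = 2·Cov_G(s(p),s(q))²`):
`∫ (a⬝v)²(b⬝v)² e^{−βvᵀPv} − [∫ (a⬝v)² e^{−βvᵀPv}]·[∫ (b⬝v)² e^{−βvᵀPv}]/Z = Z · 2·S(a,b)²`, written without division as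
`Z · ∫ (a⬝v)²(b⬝v)² = (∫ (a⬝v)²)(∫ (b⬝v)²) + Z² · 2 S(a,b)²`. -/
theorem integral_sq_mul_sq_mul_exp_quadForm (n : ℕ) (P : Matrix (Fin n) (Fin n) ℝ) (hP : P.PosDef)
    {β : ℝ} (hβ : 0 < β) (a b : Fin n → ℝ) :
    Real.sqrt (Real.pi / β) ^ n / Real.sqrt P.det *
        ∫ v : Fin n → ℝ, (a ⬝ᵥ v) ^ 2 * (b ⬝ᵥ v) ^ 2 * Real.exp (-(β * (v ⬝ᵥ P *ᵥ v))) =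
      (∫ v : Fin n → ℝ, (a ⬝ᵥ v) ^ 2 * Real.exp (-(β * (v ⬝ᵥ P *ᵥ v)))) *
        (∫ v : Fin n → ℝ, (b ⬝ᵥ v) ^ 2 * Real.exp (-(β * (v ⬝ᵥ P *ᵥ v)))) +
      (Real.sqrt (Real.pi / β) ^ n / Real.sqrt P.det) ^ 2 * (2 * ((2 * β)⁻¹ * (a ⬝ᵥ (P⁻¹ *ᵥ b))) ^ 2) := by
  have h4 := integral_four_dotProduct_mul_exp_quadForm n P hP hβ a a b b
  have ha := integral_dotProduct_mul_dotProduct_mul_exp_quadForm n P hP hβ a a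
  have hb := integral_dotProduct_mul_dotProduct_mul_exp_quadForm n P hP hβ b b
  have h4' : ∫ v : Fin n → ℝ, (a ⬝ᵥ v) ^ 2 * (b ⬝ᵥ v) ^ 2 * Real.exp (-(β * (v ⬝ᵥ P *ᵥ v))) =
      ∫ v : Fin n → ℝ, (a ⬝ᵥ v) * (a ⬝ᵥ v) * (b ⬝ᵥ v) * (b ⬝ᵥ v) * Real.exp (-(β * (v ⬝ᵥ P *ᵥ v))) :=
    integral_congr_ae (Filter.Eventually.of_forall fun v => by ring)
  have ha' : ∫ v : Fin n → ℝ, (a ⬝ᵥ v) ^ 2 * Real.exp (-(β * (v ⬝ᵥ P *ᵥ v))) =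
      ∫ v : Fin n → ℝ, (a ⬝ᵥ v) * (a ⬝ᵥ v) * Real.exp (-(β * (v ⬝ᵥ P *ᵥ v))) :=
    integral_congr_ae (Filter.Eventually.of_forall fun v => by ring)
  have hb' : ∫ v : Fin n → ℝ, (b ⬝ᵥ v) ^ 2 * Real.exp (-(β * (v ⬝ᵥ P *ᵥ v))) =
      ∫ v : Fin n → ℝ, (b ⬝ᵥ v) * (b ⬝ᵥ v) * Real.exp (-(β * (v ⬝ᵥ P *ᵥ v))) :=
    integral_congr_ae (Filter.Eventually.of_forall fun v => by ring)
  rw [h4', ha', hb', h4, ha, hb]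
  ring

end Summit.QuantumFields.YangMills.Theorems.AllWindowsColdBoxBoxHighLine

end
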